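import Mathlib
import HarnessLib
import Literature.MathematicalPhysics.QuantumLattice.HubbardSliceSymbolSmooth

/-!
# Route `KLProgramme` — crux K3 split, ENGINE child (`KLRegimeEngineV11` stmt-HubbardSuperconductivity-19823): an EXPLICIT bound on the derivative
# of Salmhofer's cutoff, `|χ₂′| ≤ 8e² (< 60)` (cell gate-hubbard-kl, seat hubbard-kl-k3c2-p2 «thermal-bar induction n ≤ nScales β + 1»)

Companion of the Literature files `HubbardFreeCovariance.lean` (`salmhoferCutoff x = smoothTransition ((4x−1)/3)`),
`SalmhoferCutoffLipschitz.lean` (`∃ L_χ`) and `HubbardSliceSymbolSmooth.lean` (`∃ B₁, B₂`).  Every numeric constant of the multiscale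
engine of cell gate-hubbard-kl (the slice weights' Lipschitz constants `ℓ/Λ_n²` in `…MatsubaraSlice*`, `…ThermalLayerExt`, the Gram/slice-symbol
bounds) is proportional to `sup|χ₂′|`, for which the tree so far only has EXISTENTIAL bounds; a registered engine package with numerals
(`klEngGeo`: `C₀ = 2^24`, `CF = 2^40`, …) needs a NUMBER.  Here it is, from Mathlib's definition
`smoothTransition x = e(x)/(e(x) + e(1−x))`, `e(x) = exp(−1/x)` (`x > 0`):
on `(0,1)`, `smoothTransition x = (1 + exp(x⁻¹ − (1−x)⁻¹))⁻¹` (`klcd_smoothTransition_eq_logistic`), whose derivative is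
`E·(x⁻² + (1−x)⁻²)/(1+E)²`, `E = exp(x⁻¹ − (1−x)⁻¹)`; using `E/(1+E)² ≤ min(E, E⁻¹)`, `(1−x)⁻¹ ≤ 2` on `(0, ½]` (resp. `x⁻¹ ≤ 2` on `[½, 1)`)
and `y²/2 ≤ exp y` (`Real.quadratic_le_exp_of_nonneg`): `|smoothTransition′| ≤ 6e²` on `(0,1)`, hence everywhere (it vanishes off `[0,1]`; the two
end points by continuity of the derivative and density) — `klcd_abs_deriv_smoothTransition_le`; and `|χ₂′| = (4/3)|smoothTransition′((4x−1)/3)| ≤ 8e²`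
(`klcd_abs_deriv_salmhoferCutoff_le`, numeric form `klcd_abs_deriv_salmhoferCutoff_lt_sixty`), so `χ₂` is `8e²`-Lipschitz (`klcd_lipschitz_salmhoferCutoff_explicit`).
Everything is proved; no definitions.

## Sources

M. Salmhofer, *Renormalization* (1999), §4.2.5 (4.70)–(4.71) (`Salmhofer1999`).
-/

noncomputable section

namespace Summit.HubbardSuperconductivity.HubbardSuperconductivity.Theorems.KLRegimeSplit

set_option linter.dupNamespace false -- summit = problem name (single-conjunct summit), D-0017

open Real Set Filter Literature.MathematicalPhysics.QuantumLattice
open scoped Topology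

/-! ## §1 The logistic form of `smoothTransition` on `(0,1)` and its derivative -/

/-- On `(0,1)`: `smoothTransition x = (1 + exp(x⁻¹ − (1−x)⁻¹))⁻¹`. [folklore] -/
theorem klcd_smoothTransition_eq_logistic {x : ℝ} (h0 : 0 < x) (h1 : x < 1) :
    Real.smoothTransition x = (1 + Real.exp (x⁻¹ - (1 - x)⁻¹))⁻¹ := by
  have h1' : 0 < 1 - x := by linarith
  have ha : expNegInvGlue x = Real.exp (-x⁻¹) := by simp [expNegInvGlue, not_le.2 h0]
  have hb : expNegInvGlue (1 - x) = Real.exp (-(1 - x)⁻¹) := by simp [expNegInvGlue, not_le.2 h1']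
  unfold Real.smoothTransition
  rw [ha, hb]
  have hpos : 0 < Real.exp (-x⁻¹) := Real.exp_pos _
  have hkey : Real.exp (-(1 - x)⁻¹) = Real.exp (-x⁻¹) * Real.exp (x⁻¹ - (1 - x)⁻¹) := by
    rw [← Real.exp_add]; ring_nf
  rw [hkey, ← mul_one_add, div_mul_eq_div_div, div_self hpos.ne', one_div]

/-- The derivative of the logistic form at `x ∈ (0,1)`: with `E = exp(x⁻¹ − (1−x)⁻¹)`,
`d/dx (1 + E)⁻¹ = E·((x⁻¹)² + ((1−x)⁻¹)²)/(1+E)²`. [folklore] -/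
theorem klcd_hasDerivAt_logistic {x : ℝ} (h0 : 0 < x) (h1 : x < 1) :
    HasDerivAt (fun y : ℝ => (1 + Real.exp (y⁻¹ - (1 - y)⁻¹))⁻¹)
      (Real.exp (x⁻¹ - (1 - x)⁻¹) * ((x⁻¹) ^ 2 + ((1 - x)⁻¹) ^ 2) / (1 + Real.exp (x⁻¹ - (1 - x)⁻¹)) ^ 2) x := by
  have hx0 : x ≠ 0 := h0.ne'
  have h1' : (1 - x) ≠ 0 := by linarith
  -- `v(y) = y⁻¹ − (1−y)⁻¹`
  have hv1 : HasDerivAt (fun y : ℝ => y⁻¹) (-(x ^ 2)⁻¹) x := hasDerivAt_inv hx0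
  have hv2 : HasDerivAt (fun y : ℝ => (1 - y)⁻¹) (((1 - x) ^ 2)⁻¹) x := by
    have hi : HasDerivAt (fun z : ℝ => z⁻¹) (-((1 - x) ^ 2)⁻¹) (1 - x) := hasDerivAt_inv h1'
    have hl : HasDerivAt (fun y : ℝ => 1 - y) (-1) x := by simpa using (hasDerivAt_id x).const_sub 1
    have := hi.comp x hl
    simpa [Function.comp_def] using this
  have hv : HasDerivAt (fun y : ℝ => y⁻¹ - (1 - y)⁻¹) (-(x ^ 2)⁻¹ - ((1 - x) ^ 2)⁻¹) x := hv1.sub hv2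
  have hF : HasDerivAt (fun y : ℝ => 1 + Real.exp (y⁻¹ - (1 - y)⁻¹))
      (Real.exp (x⁻¹ - (1 - x)⁻¹) * (-(x ^ 2)⁻¹ - ((1 - x) ^ 2)⁻¹)) x := by
    simpa using hv.exp.const_add 1
  have hne : 1 + Real.exp (x⁻¹ - (1 - x)⁻¹) ≠ 0 := by positivity
  have hinv := hF.inv hne
  have hgoal : -(Real.exp (x⁻¹ - (1 - x)⁻¹) * (-(x ^ 2)⁻¹ - ((1 - x) ^ 2)⁻¹)) / (1 + Real.exp (x⁻¹ - (1 - x)⁻¹)) ^ 2 =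
      Real.exp (x⁻¹ - (1 - x)⁻¹) * ((x⁻¹) ^ 2 + ((1 - x)⁻¹) ^ 2) / (1 + Real.exp (x⁻¹ - (1 - x)⁻¹)) ^ 2 := by
    rw [inv_pow, inv_pow]; ring
  have h2 := hinv.congr_deriv hgoal
  simpa only [Pi.inv_def] using h2

/-- `u²·e^{−u} ≤ 2` for `u ≥ 0` (from `1 + u + u²/2 ≤ e^u`). [folklore] -/
theorem klcd_sq_mul_exp_neg_le_two {u : ℝ} (hu : 0 ≤ u) : u ^ 2 * Real.exp (-u) ≤ 2 := by
  have h := Real.quadratic_le_exp_of_nonneg hu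
  have hpos := Real.exp_pos u
  rw [Real.exp_neg, ← div_eq_mul_inv, div_le_iff₀ hpos]
  nlinarith

/-- **The elementary inequality**: for `u, w > 0` with `u ≤ 2` or `w ≤ 2`,
`exp(u−w)·(u² + w²)/(1 + exp(u−w))² ≤ 6e²`. [folklore] -/
theorem klcd_logistic_deriv_le {u w : ℝ} (hu : 0 < u) (hw : 0 < w) (h : u ≤ 2 ∨ w ≤ 2) :
    Real.exp (u - w) * (u ^ 2 + w ^ 2) / (1 + Real.exp (u - w)) ^ 2 ≤ 6 * Real.exp 2 := by
  set E := Real.exp (u - w) with hE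
  have hEpos : 0 < E := Real.exp_pos _
  have hden : 0 < (1 + E) ^ 2 := by positivity
  have he2 : 0 < Real.exp 2 := Real.exp_pos 2
  have hu2 := klcd_sq_mul_exp_neg_le_two hu.le
  have hw2 := klcd_sq_mul_exp_neg_le_two hw.le
  rcases h with hu' | hw'
  · -- use `E/(1+E)² ≤ E = e^u e^{-w} ≤ e² e^{-w}`
    have hstep : E * (u ^ 2 + w ^ 2) / (1 + E) ^ 2 ≤ E * (u ^ 2 + w ^ 2) := by
      rw [div_le_iff₀ hden]
      have : 1 ≤ (1 + E) ^ 2 := by nlinarith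
      nlinarith [mul_nonneg hEpos.le (add_nonneg (sq_nonneg u) (sq_nonneg w))]
    refine hstep.trans ?_
    have hEle : E ≤ Real.exp 2 * Real.exp (-w) := by
      rw [hE, ← Real.exp_add]; exact Real.exp_le_exp.mpr (by linarith)
    have hu4 : u ^ 2 ≤ 4 := by nlinarith
    have hwexp : Real.exp (-w) ≤ 1 := by rw [Real.exp_le_one_iff]; linarith
    calc E * (u ^ 2 + w ^ 2) ≤ Real.exp 2 * Real.exp (-w) * (u ^ 2 + w ^ 2) :=
          mul_le_mul_of_nonneg_right hEle (by positivity)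
      _ = Real.exp 2 * (u ^ 2 * Real.exp (-w) + w ^ 2 * Real.exp (-w)) := by ring
      _ ≤ Real.exp 2 * (4 * 1 + 2) := by
          refine mul_le_mul_of_nonneg_left (add_le_add ?_ hw2) he2.le
          exact mul_le_mul hu4 hwexp (Real.exp_pos _).le (by norm_num)
      _ = 6 * Real.exp 2 := by ring
  · -- use `E/(1+E)² ≤ E⁻¹ = e^w e^{-u} ≤ e² e^{-u}`
    have hstep : E * (u ^ 2 + w ^ 2) / (1 + E) ^ 2 ≤ E⁻¹ * (u ^ 2 + w ^ 2) := by
      rw [div_le_iff₀ hden]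
      have hsq : 0 ≤ u ^ 2 + w ^ 2 := by positivity
      have : E * (u ^ 2 + w ^ 2) = E⁻¹ * (u ^ 2 + w ^ 2) * E ^ 2 := by field_simp
      rw [this]
      refine mul_le_mul_of_nonneg_left ?_ (by positivity)
      nlinarith
    refine hstep.trans ?_
    have hEle : E⁻¹ ≤ Real.exp 2 * Real.exp (-u) := by
      rw [hE, ← Real.exp_neg, ← Real.exp_add]; exact Real.exp_le_exp.mpr (by linarith)
    have hw4 : w ^ 2 ≤ 4 := by nlinarith
    have huexp : Real.exp (-u) ≤ 1 := by rw [Real.exp_le_one_iff]; linarith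
    calc E⁻¹ * (u ^ 2 + w ^ 2) ≤ Real.exp 2 * Real.exp (-u) * (u ^ 2 + w ^ 2) :=
          mul_le_mul_of_nonneg_right hEle (by positivity)
      _ = Real.exp 2 * (u ^ 2 * Real.exp (-u) + w ^ 2 * Real.exp (-u)) := by ring
      _ ≤ Real.exp 2 * (2 + 4 * 1) := by
          refine mul_le_mul_of_nonneg_left (add_le_add hu2 ?_) he2.le
          exact mul_le_mul hw4 huexp (Real.exp_pos _).le (by norm_num)
      _ = 6 * Real.exp 2 := by ring

/-! ## §2 The bound on `smoothTransition′` -/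

/-- On `(0,1)`: `|smoothTransition′ x| ≤ 6e²`. [folklore] -/
theorem klcd_abs_deriv_smoothTransition_le_of_mem_Ioo {x : ℝ} (h0 : 0 < x) (h1 : x < 1) :
    |deriv Real.smoothTransition x| ≤ 6 * Real.exp 2 := by
  have hev : Real.smoothTransition =ᶠ[𝓝 x] fun y : ℝ => (1 + Real.exp (y⁻¹ - (1 - y)⁻¹))⁻¹ := by
    filter_upwards [Ioo_mem_nhds h0 h1] with y hy
    exact klcd_smoothTransition_eq_logistic hy.1 hy.2
  have hder := (klcd_hasDerivAt_logistic h0 h1).congr_of_eventuallyEq hev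
  rw [hder.deriv]
  have hu : 0 < x⁻¹ := inv_pos.mpr h0
  have hw : 0 < (1 - x)⁻¹ := inv_pos.mpr (by linarith)
  have hnn : 0 ≤ Real.exp (x⁻¹ - (1 - x)⁻¹) * ((x⁻¹) ^ 2 + ((1 - x)⁻¹) ^ 2) / (1 + Real.exp (x⁻¹ - (1 - x)⁻¹)) ^ 2 := by
    positivity
  rw [abs_of_nonneg hnn]
  refine klcd_logistic_deriv_le hu hw ?_
  rcases le_or_gt x (1 / 2) with hx | hx
  · right
    rw [inv_le_comm₀ (by linarith) (by norm_num)]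
    linarith
  · left
    rw [inv_le_comm₀ h0 (by norm_num)]
    linarith

/-- Off `[0,1]` the derivative vanishes: `x < 0`. [folklore] -/
theorem klcd_deriv_smoothTransition_eq_zero_of_neg {x : ℝ} (hx : x < 0) : deriv Real.smoothTransition x = 0 := by
  have hev : Real.smoothTransition =ᶠ[𝓝 x] fun _ => (0 : ℝ) := by
    filter_upwards [Iio_mem_nhds hx] with y hy
    exact Real.smoothTransition.zero_of_nonpos hy.le
  rw [hev.deriv_eq]; simp

/-- **`|smoothTransition′| ≤ 6e²` on all of `ℝ`** (the end points `0, 1` by continuity of the derivative and density). [folklore] -/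
theorem klcd_abs_deriv_smoothTransition_le (x : ℝ) : |deriv Real.smoothTransition x| ≤ 6 * Real.exp 2 := by
  -- the bound holds on the dense set `{0}ᶜ ∩ {1}ᶜ`
  have hD : ∀ y ∈ ({0}ᶜ ∩ {1}ᶜ : Set ℝ), |deriv Real.smoothTransition y| ≤ 6 * Real.exp 2 := by
    intro y hy
    have hy0 : y ≠ 0 := hy.1
    have hy1 : y ≠ 1 := hy.2
    rcases lt_or_gt_of_ne hy0 with h | h
    · rw [klcd_deriv_smoothTransition_eq_zero_of_neg h, abs_zero]; positivity
    · rcases lt_or_gt_of_ne hy1 with h' | h'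
      · exact klcd_abs_deriv_smoothTransition_le_of_mem_Ioo h h'
      · -- above `1` the function is constant (`= 1`), so the derivative vanishes
        have hev : Real.smoothTransition =ᶠ[𝓝 y] fun _ => (1 : ℝ) := by
          filter_upwards [Ioi_mem_nhds h'] with z hz
          exact Real.smoothTransition.one_of_one_le hz.le
        rw [hev.deriv_eq]; simp; positivity
  have hdense : Dense ({0}ᶜ ∩ {1}ᶜ : Set ℝ) :=
    (dense_compl_singleton 0).inter_of_isOpen_left (dense_compl_singleton 1) isOpen_compl_singleton
  have hcont : Continuous fun y => |deriv Real.smoothTransition y| :=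
    ((Real.smoothTransition.contDiff (n := 1)).continuous_deriv le_rfl).abs
  have hclosed : IsClosed {y : ℝ | |deriv Real.smoothTransition y| ≤ 6 * Real.exp 2} :=
    isClosed_le hcont continuous_const
  have hsub : closure ({0}ᶜ ∩ {1}ᶜ : Set ℝ) ⊆ {y : ℝ | |deriv Real.smoothTransition y| ≤ 6 * Real.exp 2} :=
    hclosed.closure_subset_iff.mpr hD
  rw [hdense.closure_eq] at hsub
  exact hsub (mem_univ x)

/-! ## §3 The bound on `χ₂′` -/

/-- **`|χ₂′ x| ≤ 8e²`** for Salmhofer's cutoff `χ₂(x) = smoothTransition((4x−1)/3)`. [cite: Salmhofer1999, §4.2.5 (4.71)] -/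
theorem klcd_abs_deriv_salmhoferCutoff_le (x : ℝ) : |deriv salmhoferCutoff x| ≤ 8 * Real.exp 2 := by
  have hℓ : HasDerivAt (fun y : ℝ => (4 * y - 1) / 3) (4 / 3) x := by
    have := ((hasDerivAt_id x).const_mul 4).sub_const 1
    have := this.div_const 3
    simpa using this
  have hs : HasDerivAt Real.smoothTransition (deriv Real.smoothTransition ((4 * x - 1) / 3)) ((4 * x - 1) / 3) :=
    ((Real.smoothTransition.contDiff (n := 1)).differentiable (by norm_num) _).hasDerivAt
  have hcomp : HasDerivAt salmhoferCutoff (deriv Real.smoothTransition ((4 * x - 1) / 3) * (4 / 3)) x := by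
    have := hs.comp x hℓ
    exact this.congr_of_eventuallyEq (Eventually.of_forall fun y => rfl)
  rw [hcomp.deriv, abs_mul, abs_of_pos (by norm_num : (0:ℝ) < 4 / 3)]
  have := klcd_abs_deriv_smoothTransition_le ((4 * x - 1) / 3)
  nlinarith [Real.exp_pos 2]

/-- Numeric form: `|χ₂′ x| < 60` (`e² < 7.39`). [folklore] -/
theorem klcd_abs_deriv_salmhoferCutoff_lt_sixty (x : ℝ) : |deriv salmhoferCutoff x| < 60 := by
  have h := klcd_abs_deriv_salmhoferCutoff_le x
  have he : Real.exp 1 < 2.7182818286 := Real.exp_one_lt_d9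
  have he0 : 0 < Real.exp 1 := Real.exp_pos 1
  have h2 : Real.exp 2 = Real.exp 1 * Real.exp 1 := by rw [← Real.exp_add]; norm_num
  nlinarith

/-- **`χ₂` is `8e²`-Lipschitz, explicitly.** [cite: Salmhofer1999, §4.2.5 (4.71)] -/
theorem klcd_lipschitz_salmhoferCutoff_explicit (x y : ℝ) : |salmhoferCutoff x - salmhoferCutoff y| ≤ 8 * Real.exp 2 * |x - y| := by
  have hdiff : Differentiable ℝ salmhoferCutoff := (contDiff_salmhoferCutoff (n := 1)).differentiable (by norm_num)
  have hb : ∀ z, ‖deriv salmhoferCutoff z‖ ≤ 8 * Real.exp 2 := fun z => by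
    rw [Real.norm_eq_abs]; exact klcd_abs_deriv_salmhoferCutoff_le z
  have h := Convex.norm_image_sub_le_of_norm_deriv_le (fun z _ => hdiff z) (fun z _ => hb z) convex_univ (mem_univ y) (mem_univ x)
  rw [Real.norm_eq_abs, Real.norm_eq_abs] at h
  exact h

/-! ## §4 The sharper bound `|smoothTransition′| ≤ 8`, `|χ₂′| ≤ 32/3 < 11` -/

/-- For `t ≥ 0`: `(4 + t)²·e^{−t} ≤ 16` (from `1 + t + t²/2 ≤ e^t`). [folklore] -/
theorem klcd_sq_add_four_mul_exp_neg_le {t : ℝ} (ht : 0 ≤ t) : (4 + t) ^ 2 * Real.exp (-t) ≤ 16 := by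
  have h := Real.quadratic_le_exp_of_nonneg ht
  have hpos := Real.exp_pos t
  rw [Real.exp_neg, ← div_eq_mul_inv, div_le_iff₀ hpos]
  nlinarith

/-- `e^{−2} ≤ 1/5`. [folklore] -/
theorem klcd_exp_neg_two_le : Real.exp (-2) ≤ 1 / 5 := by
  have h := Real.quadratic_le_exp_of_nonneg (show (0:ℝ) ≤ 2 by norm_num)
  have hpos := Real.exp_pos (2 : ℝ)
  rw [Real.exp_neg, inv_eq_one_div, div_le_div_iff₀ hpos (by norm_num)]
  nlinarith

/-- **The sharper elementary inequality**: for `u, w > 0` with `(u ≤ 4 ∧ w ≤ 4) ∨ (4 ≤ u ∧ w ≤ 2) ∨ (4 ≤ w ∧ u ≤ 2)`,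
`exp(u−w)·(u² + w²)/(1 + exp(u−w))² ≤ 8`. [folklore] -/
theorem klcd_logistic_deriv_le_eight {u w : ℝ} (hu : 0 < u) (hw : 0 < w)
    (h : (u ≤ 4 ∧ w ≤ 4) ∨ (4 ≤ u ∧ w ≤ 2) ∨ (4 ≤ w ∧ u ≤ 2)) :
    Real.exp (u - w) * (u ^ 2 + w ^ 2) / (1 + Real.exp (u - w)) ^ 2 ≤ 8 := by
  set E := Real.exp (u - w) with hE
  have hEpos : 0 < E := Real.exp_pos _
  have hden : 0 < (1 + E) ^ 2 := by positivity
  rcases h with ⟨hu4, hw4⟩ | ⟨hu4, hw2⟩ | ⟨hw4, hu2⟩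
  · -- middle: `E/(1+E)² ≤ 1/4`, `u² + w² ≤ 32`
    rw [div_le_iff₀ hden]
    have hsq : u ^ 2 + w ^ 2 ≤ 32 := by nlinarith
    have hkey : E * (u ^ 2 + w ^ 2) ≤ E * 32 := mul_le_mul_of_nonneg_left hsq hEpos.le
    nlinarith [sq_nonneg (1 - E), mul_nonneg hEpos.le (sq_nonneg (1 - E))]
  · -- `u ≥ 4`, `w ≤ 2`: `E/(1+E)² ≤ E⁻¹ = e^{w−4}·e^{−(u−4)}`
    have hstep : E * (u ^ 2 + w ^ 2) / (1 + E) ^ 2 ≤ E⁻¹ * (u ^ 2 + w ^ 2) := by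
      rw [div_le_iff₀ hden]
      have : E * (u ^ 2 + w ^ 2) = E⁻¹ * (u ^ 2 + w ^ 2) * E ^ 2 := by field_simp
      rw [this]
      refine mul_le_mul_of_nonneg_left ?_ (by positivity)
      nlinarith
    refine hstep.trans ?_
    have hEinv : E⁻¹ = Real.exp (w - 4) * Real.exp (-(u - 4)) := by
      rw [hE, ← Real.exp_neg, ← Real.exp_add]; ring_nf
    rw [hEinv]
    have h1 : Real.exp (w - 4) ≤ 1 / 5 :=
      (Real.exp_le_exp.mpr (by linarith)).trans klcd_exp_neg_two_le
    have h2 : u ^ 2 * Real.exp (-(u - 4)) ≤ 16 := by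
      have := klcd_sq_add_four_mul_exp_neg_le (t := u - 4) (by linarith)
      have heq : (4 + (u - 4)) = u := by ring
      rwa [heq] at this
    have h3 : w ^ 2 * Real.exp (-(u - 4)) ≤ 4 := by
      have hw2' : w ^ 2 ≤ 4 := by nlinarith
      have hex : Real.exp (-(u - 4)) ≤ 1 := by rw [Real.exp_le_one_iff]; linarith
      calc w ^ 2 * Real.exp (-(u - 4)) ≤ 4 * 1 := mul_le_mul hw2' hex (Real.exp_pos _).le (by norm_num)
        _ = 4 := by ring
    calc Real.exp (w - 4) * Real.exp (-(u - 4)) * (u ^ 2 + w ^ 2)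
        = Real.exp (w - 4) * (u ^ 2 * Real.exp (-(u - 4)) + w ^ 2 * Real.exp (-(u - 4))) := by ring
      _ ≤ (1 / 5) * (16 + 4) := mul_le_mul h1 (add_le_add h2 h3) (by positivity) (by norm_num)
      _ ≤ 8 := by norm_num
  · -- `w ≥ 4`, `u ≤ 2`: `E/(1+E)² ≤ E = e^{u−4}·e^{−(w−4)}`
    have hstep : E * (u ^ 2 + w ^ 2) / (1 + E) ^ 2 ≤ E * (u ^ 2 + w ^ 2) := by
      rw [div_le_iff₀ hden]
      have : 1 ≤ (1 + E) ^ 2 := by nlinarith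
      nlinarith [mul_nonneg hEpos.le (add_nonneg (sq_nonneg u) (sq_nonneg w))]
    refine hstep.trans ?_
    have hEeq : E = Real.exp (u - 4) * Real.exp (-(w - 4)) := by
      rw [hE, ← Real.exp_add]; ring_nf
    rw [hEeq]
    have h1 : Real.exp (u - 4) ≤ 1 / 5 :=
      (Real.exp_le_exp.mpr (by linarith)).trans klcd_exp_neg_two_le
    have h2 : w ^ 2 * Real.exp (-(w - 4)) ≤ 16 := by
      have := klcd_sq_add_four_mul_exp_neg_le (t := w - 4) (by linarith)
      have heq : (4 + (w - 4)) = w := by ring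
      rwa [heq] at this
    have h3 : u ^ 2 * Real.exp (-(w - 4)) ≤ 4 := by
      have hu2' : u ^ 2 ≤ 4 := by nlinarith
      have hex : Real.exp (-(w - 4)) ≤ 1 := by rw [Real.exp_le_one_iff]; linarith
      calc u ^ 2 * Real.exp (-(w - 4)) ≤ 4 * 1 := mul_le_mul hu2' hex (Real.exp_pos _).le (by norm_num)
        _ = 4 := by ring
    calc Real.exp (u - 4) * Real.exp (-(w - 4)) * (u ^ 2 + w ^ 2)
        = Real.exp (u - 4) * (u ^ 2 * Real.exp (-(w - 4)) + w ^ 2 * Real.exp (-(w - 4))) := by ring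
      _ ≤ (1 / 5) * (4 + 16) := mul_le_mul h1 (add_le_add h3 h2) (by positivity) (by norm_num)
      _ ≤ 8 := by norm_num

/-- **On `(0,1)`: `|smoothTransition′ x| ≤ 8`.** [folklore] -/
theorem klcd_abs_deriv_smoothTransition_le_eight_of_mem_Ioo {x : ℝ} (h0 : 0 < x) (h1 : x < 1) :
    |deriv Real.smoothTransition x| ≤ 8 := by
  have hev : Real.smoothTransition =ᶠ[𝓝 x] fun y : ℝ => (1 + Real.exp (y⁻¹ - (1 - y)⁻¹))⁻¹ := by
    filter_upwards [Ioo_mem_nhds h0 h1] with y hy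
    exact klcd_smoothTransition_eq_logistic hy.1 hy.2
  have hder := (klcd_hasDerivAt_logistic h0 h1).congr_of_eventuallyEq hev
  rw [hder.deriv]
  have hx1 : 0 < 1 - x := by linarith
  have hu : 0 < x⁻¹ := inv_pos.mpr h0
  have hw : 0 < (1 - x)⁻¹ := inv_pos.mpr hx1
  have hnn : 0 ≤ Real.exp (x⁻¹ - (1 - x)⁻¹) * ((x⁻¹) ^ 2 + ((1 - x)⁻¹) ^ 2) / (1 + Real.exp (x⁻¹ - (1 - x)⁻¹)) ^ 2 := by
    positivity
  rw [abs_of_nonneg hnn]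
  refine klcd_logistic_deriv_le_eight hu hw ?_
  -- the three regions `x < 1/4`, `1/4 ≤ x ≤ 3/4`, `3/4 < x`
  rcases lt_or_ge x (1 / 4) with hx | hx
  · right; left
    constructor
    · rw [le_inv_comm₀ (by norm_num) h0]; linarith
    · rw [inv_le_comm₀ hx1 (by norm_num)]; linarith
  · rcases le_or_gt x (3 / 4) with hx' | hx'
    · left
      constructor
      · rw [inv_le_comm₀ h0 (by norm_num)]; linarith
      · rw [inv_le_comm₀ hx1 (by norm_num)]; linarith
    · right; right
      constructor
      · rw [le_inv_comm₀ (by norm_num) hx1]; linarith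
      · rw [inv_le_comm₀ h0 (by norm_num)]; linarith

/-- **`|smoothTransition′| ≤ 8` on all of `ℝ`.** [folklore] -/
theorem klcd_abs_deriv_smoothTransition_le_eight (x : ℝ) : |deriv Real.smoothTransition x| ≤ 8 := by
  have hD : ∀ y ∈ ({0}ᶜ ∩ {1}ᶜ : Set ℝ), |deriv Real.smoothTransition y| ≤ 8 := by
    intro y hy
    have hy0 : y ≠ 0 := hy.1
    have hy1 : y ≠ 1 := hy.2
    rcases lt_or_gt_of_ne hy0 with h | h
    · rw [klcd_deriv_smoothTransition_eq_zero_of_neg h, abs_zero]; norm_num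
    · rcases lt_or_gt_of_ne hy1 with h' | h'
      · exact klcd_abs_deriv_smoothTransition_le_eight_of_mem_Ioo h h'
      · have hev : Real.smoothTransition =ᶠ[𝓝 y] fun _ => (1 : ℝ) := by
          filter_upwards [Ioi_mem_nhds h'] with z hz
          exact Real.smoothTransition.one_of_one_le hz.le
        rw [hev.deriv_eq]; simp
  have hdense : Dense ({0}ᶜ ∩ {1}ᶜ : Set ℝ) :=
    (dense_compl_singleton 0).inter_of_isOpen_left (dense_compl_singleton 1) isOpen_compl_singleton
  have hcont : Continuous fun y => |deriv Real.smoothTransition y| :=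
    ((Real.smoothTransition.contDiff (n := 1)).continuous_deriv le_rfl).abs
  have hclosed : IsClosed {y : ℝ | |deriv Real.smoothTransition y| ≤ 8} := isClosed_le hcont continuous_const
  have hsub : closure ({0}ᶜ ∩ {1}ᶜ : Set ℝ) ⊆ {y : ℝ | |deriv Real.smoothTransition y| ≤ 8} :=
    hclosed.closure_subset_iff.mpr hD
  rw [hdense.closure_eq] at hsub
  exact hsub (mem_univ x)

/-- **`|χ₂′ x| ≤ 32/3 (< 11)`** — the sharper form of `klcd_abs_deriv_salmhoferCutoff_le`. [cite: Salmhofer1999, §4.2.5 (4.71)] -/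
theorem klcd_abs_deriv_salmhoferCutoff_le_sharp (x : ℝ) : |deriv salmhoferCutoff x| ≤ 32 / 3 := by
  have hℓ : HasDerivAt (fun y : ℝ => (4 * y - 1) / 3) (4 / 3) x := by
    have := ((hasDerivAt_id x).const_mul 4).sub_const 1
    have := this.div_const 3
    simpa using this
  have hs : HasDerivAt Real.smoothTransition (deriv Real.smoothTransition ((4 * x - 1) / 3)) ((4 * x - 1) / 3) :=
    ((Real.smoothTransition.contDiff (n := 1)).differentiable (by norm_num) _).hasDerivAt
  have hcomp : HasDerivAt salmhoferCutoff (deriv Real.smoothTransition ((4 * x - 1) / 3) * (4 / 3)) x := by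
    have := hs.comp x hℓ
    exact this.congr_of_eventuallyEq (Eventually.of_forall fun y => rfl)
  rw [hcomp.deriv, abs_mul, abs_of_pos (by norm_num : (0:ℝ) < 4 / 3)]
  have := klcd_abs_deriv_smoothTransition_le_eight ((4 * x - 1) / 3)
  nlinarith

/-- **`χ₂` is `(32/3)`-Lipschitz, explicitly.** [cite: Salmhofer1999, §4.2.5 (4.71)] -/
theorem klcd_lipschitz_salmhoferCutoff_sharp (x y : ℝ) : |salmhoferCutoff x - salmhoferCutoff y| ≤ 32 / 3 * |x - y| := by
  have hdiff : Differentiable ℝ salmhoferCutoff := (contDiff_salmhoferCutoff (n := 1)).differentiable (by norm_num)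
  have hb : ∀ z, ‖deriv salmhoferCutoff z‖ ≤ 32 / 3 := fun z => by
    rw [Real.norm_eq_abs]; exact klcd_abs_deriv_salmhoferCutoff_le_sharp z
  have h := Convex.norm_image_sub_le_of_norm_deriv_le (fun z _ => hdiff z) (fun z _ => hb z) convex_univ (mem_univ y) (mem_univ x)
  rw [Real.norm_eq_abs, Real.norm_eq_abs] at h
  exact h

end Summit.HubbardSuperconductivity.HubbardSuperconductivity.Theorems.KLRegimeSplit

end
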